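import Mathlib
import Literature.AlgebraicGeometry.Resolution.WeightedResolutionDatum
import Literature.AlgebraicGeometry.Resolution.CobordantBlowupFiltration
import Literature.AlgebraicGeometry.Resolution.CobordantBlowupRegularCentre
import Literature.AlgebraicGeometry.Resolution.ProjectiveSpaceRegular
import Literature.AlgebraicGeometry.Resolution.AlterationsProofs
import Literature.AlgebraicGeometry.Resolution.AlterationsLemma32
import Literature.AlgebraicGeometry.Resolution.SmoothOfRegularPerfectField
import Summits.ResolutionOfSingularities.ResolutionOfSingularities.Theses.WeightedInvariant

/-!
# `WeightedThesis` — bridge: the datum's affine cobordant blow-up is Włodarczyk's, hence regular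

Support lemmas for crux `stmt-ResolutionOfSingularities-0569`
(`Summit.ResolutionOfSingularities.ResolutionOfSingularities.Theses.WeightedInvariant.WeightedThesis`),
line `datum-glued-split` (RESHAPE 2), stub `stub_datumToHypersurfaceNonminimal` (a weighted
resolution datum resolves every integral hypersurface of a smooth ambient): the TOWER half of that
stub iterates the datum's cobordant blow-up, and the datum's axioms apply to the new ambient
`B₊(U)` only once it is known to be smooth, i.e. regular (`SmoothOfRegularPerfectField.lean`).

The interface `Literature.AlgebraicGeometry.Resolution.WeightedResolutionDatum` states axiom `(iv)`
with ITS OWN affine constructions — `extReesAlgebra I` (an `Algebra.adjoin`), `affineCobordantBlowup I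
= Spec A[t⁻¹, Iₙ tⁿ]`, `affineCobordantBlowup.plus`, `ReesAlgebraData.cobordantPlus U` — while the
cobordant blow-up LIBRARY (`CobordantBlowupAlgebra/…/CobordantBlowupRegularCentre.lean`, definition
request `defn-CobordantBlowup`) proves Włodarczyk's §2.3.9 regularity for `cobordantAlgebra u w` /
`cobordantBlowup u w` and the coefficient-wise `IdealFiltration.extendedRees`. This file identifies
the two on a weighted chart and transports the regularity:

* `weightedMonomialIdeal_eq_weightedFiltration_ideal` — the datum's monomial ideals
  `(u^α : Σ wᵢ αᵢ ≥ n)` (exponents `Fin m → ℕ`) are the library's (exponents `Fin m →₀ ℕ`);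
* `extReesAlgebra_eq_extendedRees` — for a descending multiplicative filtration, the datum's
  generated algebra `A[t⁻¹, Jₙ tⁿ]` equals the library's coefficient-wise extended Rees algebra;
* `extReesAlgebra_chartIdeals_eq_cobordantAlgebra` — on a weighted chart `(U, u, w)` of a Rees
  algebra `R` on `Y`, `Γ(U)[t⁻¹, Rₙ(U) tⁿ] = cobordantAlgebra u w`;
* `isRegularRing_extReesAlgebra_of_isWeightedChart`, `isRegular_affineCobordantBlowup_of_isWeightedChart`,
  `stub_isRegular_cobordantPlus_of_isWeightedChart` — **on a weighted chart of a regular locally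
  Noetherian `Y`, the datum's full cobordant blow-up `B(U)` and its cobordant blow-up `B₊(U)` are
  regular schemes** (Włodarczyk 2022, §2.3.9, through
  `cobordantAlgebra.isRegularRing_of_linearIndependent_toCotangent`).

No definition is declared; all proofs are glue on Mathlib and the tree.
-/

noncomputable section

open CategoryTheory AlgebraicGeometry TopologicalSpace
open scoped LaurentPolynomial
open LaurentPolynomial
open Literature.AlgebraicGeometry.Resolution

set_option linter.dupNamespace false

namespace Summit.ResolutionOfSingularities.ResolutionOfSingularities.Theorems.WeightedThesis.DatumCobordantBridge

universe u

/-! ## The two renderings of the weighted monomial ideals agree -/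

section Monomial

variable {A : Type u} [CommRing A] {m : ℕ} (u : Fin m → A) (w : Fin m → ℕ)

/-- The generating monomials agree: exponent vectors `Fin m → ℕ` versus finitely supported
functions `Fin m →₀ ℕ`. [folklore] -/
theorem setOf_weightedMonomial_eq (n : ℕ) :
    {x : A | ∃ α : Fin m → ℕ, n ≤ ∑ i, w i * α i ∧ x = ∏ i, u i ^ α i} =
      weightedMonomials u w n := by
  ext x
  constructor
  · rintro ⟨α, hα, rfl⟩
    refine ⟨Finsupp.equivFunOnFinite.symm α, ?_, ?_⟩
    · rw [Finsupp.weight_apply, Finsupp.sum_fintype _ _ (fun i => by simp)]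
      simpa [Finsupp.coe_equivFunOnFinite_symm, smul_eq_mul, mul_comm] using hα
    · rw [Finsupp.prod_fintype _ _ (fun i => by simp)]
      simp
  · rintro ⟨α, hα, rfl⟩
    refine ⟨⇑α, ?_, ?_⟩
    · rw [Finsupp.weight_apply, Finsupp.sum_fintype _ _ (fun i => by simp)] at hα
      simpa [smul_eq_mul, mul_comm] using hα
    · rw [Finsupp.prod_fintype _ _ (fun i => by simp)]

/-- **The datum's weighted monomial ideal is the library's**:
`weightedMonomialIdeal u w n = 𝒥ₙ(u, w)`. [cite: Wlodarczyk2022, Lemma 2.1.12] -/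
theorem weightedMonomialIdeal_eq_weightedFiltration_ideal (n : ℕ) :
    weightedMonomialIdeal u w n = (weightedFiltration u w).ideal n := by
  rw [weightedMonomialIdeal, weightedFiltration_ideal, setOf_weightedMonomial_eq]

end Monomial

/-! ## The two renderings of the extended Rees algebra agree -/

section Rees

variable {A : Type u} [CommRing A]

/-- `a t⁻ᵏ ∈ A[t⁻¹, Jₙ tⁿ]`. [folklore] -/
theorem C_mul_T_neg_natCast_mem_extReesAlgebra (I : ℕ → Ideal A) (a : A) (k : ℕ) :
    C a * T (-(k : ℤ)) ∈ extReesAlgebra I := by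
  refine Subalgebra.mul_mem _ ?_ ?_
  · rw [C_eq_algebraMap]
    exact Subalgebra.algebraMap_mem _ a
  · have hT : (T (-(k : ℤ)) : A[T;T⁻¹]) = T (-1) ^ k := by
      rw [T_pow]; congr 1; ring
    rw [hT]
    exact Subalgebra.pow_mem _ (Algebra.subset_adjoin (Set.mem_insert _ _)) k

/-- **The datum's extended Rees algebra is the library's**: for a descending multiplicative
filtration `F`, the subalgebra of `A[t, t⁻¹]` generated by `t⁻¹` and the `a tⁿ` (`n ≥ 1`,
`a ∈ Jₙ`) is the subalgebra of Laurent polynomials whose `tⁿ`-coefficient lies in `Jₙ` for all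
`n ≥ 0`. [cite: Wlodarczyk2022, Def. 5.1.1] -/
theorem extReesAlgebra_eq_extendedRees (F : IdealFiltration A) :
    extReesAlgebra F.ideal = F.extendedRees := by
  apply le_antisymm
  · refine Algebra.adjoin_le ?_
    rintro x (rfl | ⟨n, _, a, ha, rfl⟩)
    · exact F.T_neg_one_mem_extendedRees
    · exact F.C_mul_T_mem_extendedRees_iff.mpr ha
  · intro p hp
    rw [← AddMonoidAlgebra.sum_coeff_single p, Finsupp.sum]
    refine Subalgebra.sum_mem _ fun n _ => ?_
    rw [single_eq_C_mul_T]
    rcases lt_or_ge n 0 with hn | hn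
    · obtain ⟨k, hk⟩ := Int.exists_eq_neg_ofNat hn.le
      rw [hk]
      exact C_mul_T_neg_natCast_mem_extReesAlgebra F.ideal _ k
    · obtain ⟨j, rfl⟩ := Int.eq_ofNat_of_zero_le hn
      have hj : p.coeff (j : ℤ) ∈ F.ideal j := (F.mem_extendedRees_iff.mp hp) j
      rcases Nat.eq_zero_or_pos j with rfl | hjpos
      · -- degree `0`: a constant
        rw [Nat.cast_zero, T_zero, mul_one, C_eq_algebraMap]
        exact Subalgebra.algebraMap_mem _ _
      · exact extReesAlgebra.C_mul_T_mem F.ideal hjpos hj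

end Rees

/-! ## On a weighted chart the datum's algebra is `cobordantAlgebra u w` -/

section Chart

variable {Y : Scheme.{u}} (R : ReesAlgebraData Y) {U : Y.affineOpens} {m : ℕ}
  {u : Fin m → Γ(Y, U)} {w : Fin m → ℕ}

/-- On a weighted chart the pieces of `R` over `U` are the weighted filtration of `(u, w)`.
[cite: Wlodarczyk2022, Lemma 2.1.12] -/
theorem chartIdeals_eq_of_isWeightedChart (h : R.IsWeightedChart U u w) :
    R.chartIdeals U = (weightedFiltration u w).ideal := by
  funext n
  rw [ReesAlgebraData.chartIdeals_apply, h.ideal_eq, weightedMonomialIdeal_eq_weightedFiltration_ideal]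

/-- **On a weighted chart `(U, u, w)`, the datum's algebra `Γ(U)[t⁻¹, Rₙ(U) tⁿ]` of the full
cobordant blow-up is Włodarczyk's `cobordantAlgebra u w = Γ(U)[t⁻¹, uᵢ t^{wᵢ}]`.**
[cite: Wlodarczyk2022, Lemma 2.1.8 and Def. 2.3.5] -/
theorem extReesAlgebra_chartIdeals_eq_cobordantAlgebra (h : R.IsWeightedChart U u w) :
    extReesAlgebra (R.chartIdeals U) = cobordantAlgebra u w := by
  rw [chartIdeals_eq_of_isWeightedChart R h, extReesAlgebra_eq_extendedRees,
    cobordantAlgebra_eq_extendedRees]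

end Chart

/-! ## Regularity of the datum's cobordant blow-up on a weighted chart -/

section Regular

variable {Y : Scheme.{u}} [IsLocallyNoetherian Y] (hY : Scheme.IsRegular Y) (R : ReesAlgebraData Y)
  {U : Y.affineOpens} {m : ℕ} {u : Fin m → Γ(Y, U)} {w : Fin m → ℕ}

omit [IsLocallyNoetherian Y] in
include hY in
/-- The hypothesis of `cobordantAlgebra.isRegularRing_of_linearIndependent_toCotangent` from a
weighted chart on a regular scheme: at every prime `P ⊇ (u)` of `Γ(Y, U)` the stalk of `Y` at the
corresponding point of `U` is a regular local ring, a localisation at `P`, in whose cotangent space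
the `uᵢ` are linearly independent. [cite: Wlodarczyk2022, Def. 2.1.10] -/
theorem exists_localization_of_isWeightedChart (h : R.IsWeightedChart U u w)
    (P : Ideal Γ(Y, U)) [P.IsPrime] (hP : Ideal.span (Set.range u) ≤ P) :
    ∃ (S : Type u) (_ : CommRing S) (_ : Algebra Γ(Y, U) S) (_ : IsLocalization.AtPrime S P)
      (_ : IsRegularLocalRing S) (hmem : ∀ i, algebraMap Γ(Y, U) S (u i) ∈ IsLocalRing.maximalIdeal S),
      LinearIndependent (IsLocalRing.ResidueField S)
        fun i => (IsLocalRing.maximalIdeal S).toCotangent ⟨algebraMap Γ(Y, U) S (u i), hmem i⟩ := by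
  let y : PrimeSpectrum Γ(Y, U) := ⟨P, ‹_›⟩
  have hy : U.2.fromSpec y ∈ (U : Y.Opens) := by
    rw [← SetLike.mem_coe, ← U.2.range_fromSpec]; exact ⟨y, rfl⟩
  letI : Algebra Γ(Y, U) (Y.presheaf.stalk (U.2.fromSpec y)) :=
    TopCat.Presheaf.algebra_section_stalk Y.presheaf ⟨U.2.fromSpec y, hy⟩
  haveI hloc : IsLocalization.AtPrime (Y.presheaf.stalk (U.2.fromSpec y)) y.asIdeal :=
    U.2.isLocalization_stalk' y hy
  haveI hreg : IsRegularLocalRing (Y.presheaf.stalk (U.2.fromSpec y)) := hY _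
  have hmem : ∀ i, algebraMap Γ(Y, U) (Y.presheaf.stalk (U.2.fromSpec y)) (u i) ∈
      IsLocalRing.maximalIdeal (Y.presheaf.stalk (U.2.fromSpec y)) := fun i =>
    (IsLocalization.AtPrime.to_map_mem_maximal_iff _ y.asIdeal (u i)).mpr
      (hP (Ideal.subset_span ⟨i, rfl⟩))
  exact ⟨Y.presheaf.stalk (U.2.fromSpec y), inferInstance, inferInstance, hloc, hreg, hmem,
    h.linearIndependent (U.2.fromSpec y) hy hmem⟩

include hY in
/-- **The datum's algebra of the full cobordant blow-up is a regular ring on a weighted chart**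
of a regular locally Noetherian scheme (Włodarczyk 2022, §2.3.9, via
`cobordantAlgebra.isRegularRing_of_linearIndependent_toCotangent`). [cite: Wlodarczyk2022, §2.3.9] -/
theorem isRegularRing_extReesAlgebra_of_isWeightedChart (h : R.IsWeightedChart U u w) :
    IsRegularRing (extReesAlgebra (R.chartIdeals U)) := by
  haveI : IsRegularRing Γ(Y, U) := hY.isRegularRing_of_isAffineOpen U.2
  rw [extReesAlgebra_chartIdeals_eq_cobordantAlgebra R h]
  exact cobordantAlgebra.isRegularRing_of_linearIndependent_toCotangent u w h.w_pos
    (fun P _ hP => exists_localization_of_isWeightedChart hY R h P hP)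

include hY in
/-- **The datum's full cobordant blow-up `B(U) = Spec Γ(U)[t⁻¹, Rₙ(U) tⁿ]` over a weighted chart
of a regular locally Noetherian scheme is a regular scheme.** [cite: Wlodarczyk2022, §2.3.9] -/
theorem isRegular_affineCobordantBlowup_of_isWeightedChart (h : R.IsWeightedChart U u w) :
    Scheme.IsRegular (affineCobordantBlowup (R.chartIdeals U)) := by
  haveI := isRegularRing_extReesAlgebra_of_isWeightedChart hY R h
  exact Scheme.isRegular_Spec (.of _)

end Regular

/-- **The datum's cobordant blow-up `B₊(U) = B(U) ∖ Vert` over a weighted chart of a regular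
locally Noetherian scheme is a regular scheme** (an open subscheme of the regular `B(U)`) — so
that, over a perfect field, the datum's axioms apply again to `(B₊(U), strict transform)`
(`smooth_of_isRegular_of_perfectField`). [cite: Wlodarczyk2022, §2.3.9] -/
theorem stub_isRegular_cobordantPlus_of_isWeightedChart :
    ∀ {Y : AlgebraicGeometry.Scheme.{0}} [AlgebraicGeometry.IsLocallyNoetherian Y], Literature.AlgebraicGeometry.Resolution.Scheme.IsRegular Y → ∀ (R : Literature.AlgebraicGeometry.Resolution.ReesAlgebraData Y) (U : Y.affineOpens) {m : ℕ} (u : Fin m → Γ(Y, U)) (w : Fin m → ℕ), R.IsWeightedChart U u w → Literature.AlgebraicGeometry.Resolution.Scheme.IsRegular (R.cobordantPlus U) := by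
  intro Y _ hY R U m u w h
  unfold ReesAlgebraData.cobordantPlus affineCobordantBlowup.plus
  exact Scheme.IsRegular.of_isOpenImmersion (affineCobordantBlowup.plusOpens (R.chartIdeals U)).ι
    (isRegular_affineCobordantBlowup_of_isWeightedChart hY R h)

/-! ## Over a perfect field: `B₊(U) → Spec k` is smooth and separated -/

section Smooth

variable {Y : Scheme.{u}} (R : ReesAlgebraData Y) {U : Y.affineOpens} {m : ℕ}
  {u : Fin m → Γ(Y, U)} {w : Fin m → ℕ}

/-- On a weighted chart the datum's algebra `Γ(U)[t⁻¹, Rₙ(U) tⁿ]` is of finite type over `Γ(U)`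
(it is `Γ(U)[t⁻¹, uᵢ t^{wᵢ}]`, a quotient of a polynomial ring in `m + 1` variables,
`cobordantAlgebra.presentation`). [cite: Wlodarczyk2022, §2.3.9] -/
theorem finiteType_extReesAlgebra_of_isWeightedChart (h : R.IsWeightedChart U u w) :
    Algebra.FiniteType Γ(Y, U) (extReesAlgebra (R.chartIdeals U)) := by
  rw [extReesAlgebra_chartIdeals_eq_cobordantAlgebra R h]
  exact Algebra.FiniteType.of_surjective (cobordantAlgebra.presentation u w)
    (cobordantAlgebra.presentation_surjective u w)

/-- On a weighted chart the datum's full cobordant blow-up `B(U) → Spec Γ(U)` is locally of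
finite type. [folklore] -/
theorem locallyOfFiniteType_π_of_isWeightedChart (h : R.IsWeightedChart U u w) :
    LocallyOfFiniteType (affineCobordantBlowup.π (R.chartIdeals U)) := by
  haveI := finiteType_extReesAlgebra_of_isWeightedChart R h
  exact (HasRingHomProperty.Spec_iff (P := @LocallyOfFiniteType)).mpr
    (RingHom.finiteType_algebraMap.mpr inferInstance)

/-- On a weighted chart the datum's cobordant blow-up `B₊(U) → Y` is locally of finite type
(open immersion, then `B(U) → Spec Γ(U) ≅ U ⊆ Y`). [folklore] -/
theorem locallyOfFiniteType_cobordantPlusι_of_isWeightedChart (h : R.IsWeightedChart U u w) :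
    LocallyOfFiniteType (R.cobordantPlusι U) := by
  haveI := locallyOfFiniteType_π_of_isWeightedChart R h
  show LocallyOfFiniteType (((affineCobordantBlowup.plusOpens (R.chartIdeals U)).ι ≫
    affineCobordantBlowup.π (R.chartIdeals U)) ≫ U.2.fromSpec)
  infer_instance

/-- The datum's cobordant blow-up `B₊(U) → Y` is separated (an open immersion followed by an
affine morphism and an open immersion). [folklore] -/
theorem isSeparated_cobordantPlusι : IsSeparated (R.cobordantPlusι U) := by
  haveI : IsSeparated (affineCobordantBlowup.π (R.chartIdeals U)) := by
    unfold affineCobordantBlowup.π affineCobordantBlowup; infer_instance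
  show IsSeparated (((affineCobordantBlowup.plusOpens (R.chartIdeals U)).ι ≫
    affineCobordantBlowup.π (R.chartIdeals U)) ≫ U.2.fromSpec)
  infer_instance

/-- On a weighted chart of a locally Noetherian `Y` the datum's full cobordant blow-up `B(U)` is
a Noetherian topological space (its ring `Γ(U)[t⁻¹, uᵢ t^{wᵢ}]` is Noetherian,
`cobordantAlgebra.isNoetherianRing`), so every morphism out of its open `B₊(U)` is quasi-compact.
[folklore] -/
theorem noetherianSpace_affineCobordantBlowup_of_isWeightedChart [IsLocallyNoetherian Y]
    (h : R.IsWeightedChart U u w) : NoetherianSpace (affineCobordantBlowup (R.chartIdeals U)) := by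
  haveI : IsNoetherianRing Γ(Y, U) := IsLocallyNoetherian.component_noetherian U
  haveI : IsNoetherianRing (extReesAlgebra (R.chartIdeals U)) := by
    rw [extReesAlgebra_chartIdeals_eq_cobordantAlgebra R h]
    exact cobordantAlgebra.isNoetherianRing u w
  change NoetherianSpace (PrimeSpectrum (extReesAlgebra (R.chartIdeals U)))
  infer_instance

/-- **Over a perfect field the datum's cobordant blow-up is again a smooth separated
quasi-compact ambient.** For `f : Y → Spec k` smooth and separated over a perfect field `k` and a
weighted chart `(U, u, w)` of a Rees algebra `R` on `Y`, the structure map `B₊(U) → U ⊆ Y → Spec k`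
of the datum's cobordant blow-up is smooth (regular by §2.3.9 and locally of finite type, hence
smooth over the perfect field, `smooth_of_isRegular_of_perfectField`), separated, and quasi-compact
(`B(U)` is Noetherian) — exactly the standing hypotheses `[Smooth] [IsSeparated] [QuasiCompact]`
under which the axioms of a `WeightedResolutionDatum` apply to `(B₊(U), strict transform)`, the
next step of the cobordant tower. [cite: Wlodarczyk2022, §2.3.9] -/
theorem stub_smooth_cobordantPlusHom_of_isWeightedChart :
    ∀ {k : Type} [Field k] [PerfectField k] {Y : AlgebraicGeometry.Scheme.{0}} (f : Y ⟶ AlgebraicGeometry.Spec (.of k)) [AlgebraicGeometry.Smooth f] [AlgebraicGeometry.IsSeparated f] (R : Literature.AlgebraicGeometry.Resolution.ReesAlgebraData Y) (U : Y.affineOpens) {m : ℕ} (u : Fin m → Γ(Y, U)) (w : Fin m → ℕ), R.IsWeightedChart U u w → AlgebraicGeometry.Smooth (R.cobordantPlusι U ≫ f) ∧ AlgebraicGeometry.IsSeparated (R.cobordantPlusι U ≫ f) ∧ AlgebraicGeometry.QuasiCompact (R.cobordantPlusι U ≫ f) := by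
  intro k _ _ Y f _ _ R U m u w h
  haveI : IsLocallyNoetherian Y := LocallyOfFiniteType.isLocallyNoetherian f
  have hY : Scheme.IsRegular Y :=
    Scheme.IsRegular.of_smooth f (Scheme.isRegular_Spec (.of k))
  haveI := locallyOfFiniteType_cobordantPlusι_of_isWeightedChart R h
  haveI := isSeparated_cobordantPlusι R (U := U)
  haveI := noetherianSpace_affineCobordantBlowup_of_isWeightedChart R h
  haveI : NoetherianSpace (R.cobordantPlus U) := by
    unfold ReesAlgebraData.cobordantPlus affineCobordantBlowup.plus
    exact (affineCobordantBlowup.plusOpens (R.chartIdeals U)).ι.isOpenEmbedding.isInducing.noetherianSpace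
  exact ⟨smooth_of_isRegular_of_perfectField _
    (stub_isRegular_cobordantPlus_of_isWeightedChart hY R U u w h), inferInstance, inferInstance⟩

end Smooth

end Summit.ResolutionOfSingularities.ResolutionOfSingularities.Theorems.WeightedThesis.DatumCobordantBridge

end
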